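import Mathlib
import Literature.Computability.AlgebraicComplexity.NestFreeMatchingPoly
import Literature.Computability.AlgebraicComplexity.MonotoneStructureHomogeneous
import Summits.ValiantsHypothesis.ValiantsHypothesis.Theorems.FifoMatchingNNLowDegreeCofactorHardSupportGenericExpBound
import Summits.ValiantsHypothesis.ValiantsHypothesis.Theorems.FifoMatchingNNLowDegreeCofactorHardCofactorBuysVertices
import HarnessLib

/-!
# Route `FifoMatching`, crux `NNLinearDegreeCofactorHard` (stmt-ValiantsHypothesis-23918), line
# `internal_cofactor`: killing an internal cofactor — reduction of stub S2b
# `stub_denseInternalHard` to a spread-measure statement on ONE sub-family of matchings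

Registered line `Cruxes/NNLinearDegreeCofactorHard/Lines/internal_cofactor.lean`.  Its load-bearing
stub S2b asks, for an INTERNAL cofactor `p ≠ 0` on a vertex set `R` (every arc variable of every
monomial of `p` has both endpoints in `R`), for `2^((log₂ n + c)^c) < L₊(NN_n · p)`.

This file removes the cofactor altogether (a helper toward S2b, landed `--supports`):

* `topComponent_rrWeight_nestFreeMatchingPoly` — for the 0/1 arc weight `w_R(x_(i,j)) = 0` if
  `i, j ∈ R` and `1` otherwise, the top `w_R`-component of `NN_n` is the 0/1 polynomial of the
  sub-family `𝓕_R := {M nest-free perfect matching of [2n] : no arc of M has both endpoints in R}`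
  (as soon as `𝓕_R ≠ ∅`); an internal cofactor is `w_R`-homogeneous of weight `0`;
* `complexity_family_mul_C_le` — hence, substituting `1` for the `R × R` variables AFTER taking the
  top `w_R`-component (both free over `ℝ≥0`: `complexity_topComponent_le`, `complexity_aeval_le`),
  `L₊(η · Σ_{M ∈ 𝓕_R} x^M) ≤ L₊(NN_n · p)` with `η = p(1,…,1) > 0`;
* `exists_balanced_split_of_complexity_family` — the union bound of
  `NNMonotoneHard.exists_balanced_split_of_complexity` for the 0/1 polynomial (times a unit) of ANY
  family `𝓕` of perfect matchings of `[2n]` and any probability weighting of `𝓕`: the monomials are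
  PERFECT matchings, so balanced product terms respect ONE vertex split — no defects, no wildcards;
* `denseInternalHard_of_familySpread` — **S2b follows from**: for some `a`, every `c`, all large
  `n` and every `R` with `a·|R| ≤ 2n` (and no defect-free run of the stub's length), a probability
  weighting of `𝓕_R` under which every balanced split `S ⊆ [2n]` (`2n < 3|S| ≤ 4n`) is respected
  with mass `< 1 / (4 · 2^((log₂ n + c)^c) · (n+1)²)`.  The degree bound `a · deg p ≤ n` of the stub
  is not used by the reduction.

Honest framing: a reduction for ONE registered stub of an OPEN crux on a conditional route; the
spread measures on `𝓕_R` are NOT constructed here; nothing here bears on `NNDivisionHard`, `NNNotVP`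
or VP ≠ VNP (NOT proved); monotone world only (`Literature.Barriers.ValiantsHypothesis.MonotoneGap`).
No definitions, no named facts.
-/

noncomputable section

-- Sub = Summit single-conjunct layout: the duplicated namespace component is mandated by the tree.
set_option linter.dupNamespace false

namespace Summit.ValiantsHypothesis.ValiantsHypothesis.Theorems.FifoMatching.NNLinearDegreeCofactorHard

open MvPolynomial Finset Literature.Computability.AlgebraicComplexity
open Summit.ValiantsHypothesis.ValiantsHypothesis.Theorems.ZeroOneTransfer.Negative
open Summit.ValiantsHypothesis.ValiantsHypothesis.Theorems.FifoMatching.NNMonotoneHard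
open Summit.ValiantsHypothesis.ValiantsHypothesis.Theorems.FifoMatching.NNLowDegreeCofactorHard
open scoped NNReal

variable {m : ℕ}

/-! ### The `R × R` weight of the arc set of a perfect matching -/

/-- The `w_R`-weight of the arc set of `M` (`w_R(x_(i,j)) = [¬ (i ∈ R ∧ j ∈ R)]`) is the number of
arcs of `M` that do not have both endpoints in `R`. [folklore] -/
theorem weight_rr_arcExponent (R : Finset (Fin m)) (M : Fin m → Fin m) :
    Finsupp.weight (fun e : Fin m × Fin m => if e.1 ∈ R ∧ e.2 ∈ R then 0 else 1) (arcExponent M)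
      = ((openers M).filter fun i => ¬ (i ∈ R ∧ M i ∈ R)).card := by
  classical
  rw [arcExponent, map_sum, card_filter]
  refine sum_congr rfl fun i _ => ?_
  rw [Finsupp.weight_single, smul_eq_mul, one_mul]
  by_cases h : i ∈ R ∧ M i ∈ R <;> simp [h]

/-- For a perfect matching `M` of `[2n]`: the `w_R`-weight of its arc set is at most `n`, with
equality iff no arc of `M` has both endpoints in `R` (`∀ r ∈ R, M r ∉ R`). [folklore] -/
theorem weight_rr_arcExponent_le {n : ℕ} (R : Finset (Fin (2 * n))) {M : Fin (2 * n) → Fin (2 * n)}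
    (hM : M ∈ perfectMatchings (2 * n)) :
    Finsupp.weight (fun e : Fin (2 * n) × Fin (2 * n) => if e.1 ∈ R ∧ e.2 ∈ R then 0 else 1)
        (arcExponent M) ≤ n ∧
      (Finsupp.weight (fun e : Fin (2 * n) × Fin (2 * n) => if e.1 ∈ R ∧ e.2 ∈ R then 0 else 1)
        (arcExponent M) = n ↔ ∀ r ∈ R, M r ∉ R) := by
  classical
  rw [weight_rr_arcExponent]
  have hco := card_openers hM
  refine ⟨(card_filter_le _ _).trans hco.le, ?_⟩
  have key : (((openers M).filter fun i => ¬ (i ∈ R ∧ M i ∈ R)).card = (openers M).card) ↔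
      ∀ r ∈ R, M r ∉ R := by
    rw [Finset.card_filter_eq_iff]
    obtain ⟨hinv, hfp⟩ := mem_perfectMatchings.1 hM
    constructor
    · intro h r hr hMr
      rcases lt_or_gt_of_ne (hfp r).symm with hlt | hgt
      · exact h r (mem_openers.2 hlt) ⟨hr, hMr⟩
      · have ho : M r ∈ openers M := mem_openers.2 (by rw [hinv]; exact hgt)
        exact h (M r) ho ⟨hMr, by rw [hinv]; exact hr⟩
    · intro h i _ hi
      exact h i hi.1 hi.2
  rw [← key, hco]

/-! ### The top `w_R`-component of `NN_n` is the polynomial of the family `𝓕_R` -/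

/-- If some nest-free perfect matching of `[2n]` has no `R × R` arc, the `w_R`-weighted total degree
of `NN_n` over `ℝ≥0` is `n`. [folklore] -/
theorem weightedTotalDegree_rr_nestFreeMatchingPoly {n : ℕ} (R : Finset (Fin (2 * n)))
    (hne : ((nestFreeMatchings (2 * n)).filter fun M => ∀ r ∈ R, M r ∉ R).Nonempty) :
    weightedTotalDegree (fun e : Fin (2 * n) × Fin (2 * n) => if e.1 ∈ R ∧ e.2 ∈ R then 0 else 1)
      (nestFreeMatchingPoly n ℝ≥0) = n := by
  classical
  apply le_antisymm
  · rw [weightedTotalDegree]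
    refine Finset.sup_le fun d hd => ?_
    rw [support_nestFreeMatchingPoly, mem_image] at hd
    obtain ⟨M, hM, rfl⟩ := hd
    exact (weight_rr_arcExponent_le R (nestFreeMatchings_subset_perfectMatchings hM)).1
  · obtain ⟨M, hM⟩ := hne
    rw [mem_filter] at hM
    have hw := ((weight_rr_arcExponent_le R (nestFreeMatchings_subset_perfectMatchings hM.1)).2).2 hM.2
    refine hw.symm.le.trans (le_weightedTotalDegree _ ?_)
    rw [support_nestFreeMatchingPoly, mem_image]
    exact ⟨M, hM.1, rfl⟩

/-- **The top `w_R`-component of `NN_n` is `Σ_{M ∈ 𝓕_R} x^M`**, where `𝓕_R` is the family of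
nest-free perfect matchings of `[2n]` without `R × R` arcs (assumed nonempty). [folklore] -/
theorem topComponent_rrWeight_nestFreeMatchingPoly {n : ℕ} (R : Finset (Fin (2 * n)))
    (hne : ((nestFreeMatchings (2 * n)).filter fun M => ∀ r ∈ R, M r ∉ R).Nonempty) :
    topComponent (fun e : Fin (2 * n) × Fin (2 * n) => if e.1 ∈ R ∧ e.2 ∈ R then 0 else 1)
        (nestFreeMatchingPoly n ℝ≥0)
      = ∑ M ∈ (nestFreeMatchings (2 * n)).filter (fun M => ∀ r ∈ R, M r ∉ R), arcMonomial ℝ≥0 M := by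
  classical
  have hsub : ((nestFreeMatchings (2 * n)).filter fun M => ∀ r ∈ R, M r ∉ R) ⊆ perfectMatchings (2 * n) :=
    (filter_subset _ _).trans nestFreeMatchings_subset_perfectMatchings
  ext d
  rw [coeff_topComponent, weightedTotalDegree_rr_nestFreeMatchingPoly R hne,
    nestFreeMatchingPoly_eq_sum_arcMonomial, coeff_sum_arcMonomial nestFreeMatchings_subset_perfectMatchings,
    coeff_sum_arcMonomial hsub]
  by_cases h : ∃ M ∈ (nestFreeMatchings (2 * n)).filter (fun M => ∀ r ∈ R, M r ∉ R), arcExponent M = d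
  · obtain ⟨M, hM, hMd⟩ := h
    have hM' := mem_filter.1 hM
    have hw := ((weight_rr_arcExponent_le R (nestFreeMatchings_subset_perfectMatchings hM'.1)).2).2 hM'.2
    rw [hMd] at hw
    rw [if_pos hw, if_pos ⟨M, hM'.1, hMd⟩, if_pos ⟨M, hM, hMd⟩]
  · rw [if_neg h]
    split_ifs with hw hex
    · exfalso
      obtain ⟨M, hM, hMd⟩ := hex
      apply h
      refine ⟨M, mem_filter.2 ⟨hM, ?_⟩, hMd⟩
      have := (weight_rr_arcExponent_le R (nestFreeMatchings_subset_perfectMatchings hM)).2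
      rw [hMd] at this
      exact this.1 hw
    · rfl
    · rfl

/-- An internal cofactor on `R` (all arc variables of all monomials inside `R × R`) is
`w_R`-homogeneous of weight `0`, hence equal to its own top `w_R`-component. [folklore] -/
theorem topComponent_rrWeight_eq_self_of_internal {n : ℕ} (R : Finset (Fin (2 * n)))
    {p : MvPolynomial (Fin (2 * n) × Fin (2 * n)) ℝ≥0}
    (hint : ∀ d ∈ p.support, ∀ e ∈ d.support, e.1 ∈ R ∧ e.2 ∈ R) :
    topComponent (fun e : Fin (2 * n) × Fin (2 * n) => if e.1 ∈ R ∧ e.2 ∈ R then 0 else 1) p = p := by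
  classical
  apply topComponent_eq_self_of_isWeightedHomogeneous _ (n := 0)
  intro d hd
  rw [Finsupp.weight_apply, Finsupp.sum]
  refine sum_eq_zero fun e he => ?_
  rw [if_pos (hint d (mem_support_iff.2 hd) e he), smul_zero]

/-! ### Substituting `1` for the `R × R` variables -/

/-- The substitution `x_e ↦ 1` (`e ∈ R × R`), `x_e ↦ x_e` otherwise, fixes `Σ_{M ∈ 𝓕_R} x^M`.
[folklore] -/
theorem aeval_rrOne_family {n : ℕ} (R : Finset (Fin (2 * n))) :
    aeval (fun e : Fin (2 * n) × Fin (2 * n) =>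
        if e.1 ∈ R ∧ e.2 ∈ R then (1 : MvPolynomial (Fin (2 * n) × Fin (2 * n)) ℝ≥0) else X e)
      (∑ M ∈ (nestFreeMatchings (2 * n)).filter (fun M => ∀ r ∈ R, M r ∉ R), arcMonomial ℝ≥0 M)
      = ∑ M ∈ (nestFreeMatchings (2 * n)).filter (fun M => ∀ r ∈ R, M r ∉ R), arcMonomial ℝ≥0 M := by
  classical
  rw [map_sum]
  refine sum_congr rfl fun M hM => ?_
  obtain ⟨-, hMR⟩ := mem_filter.1 hM
  rw [arcMonomial_eq_prod_openers, map_prod]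
  refine prod_congr rfl fun i hi => ?_
  rw [aeval_X, if_neg]
  rintro ⟨hiR, hMiR⟩
  exact hMR i hiR hMiR

/-- The substitution `x_e ↦ 1` (`e ∈ R × R`) turns an internal cofactor on `R` into the constant
`η = Σ coeff`, which is nonzero if the cofactor is. [folklore] -/
theorem aeval_rrOne_internal {n : ℕ} (R : Finset (Fin (2 * n)))
    {p : MvPolynomial (Fin (2 * n) × Fin (2 * n)) ℝ≥0}
    (hint : ∀ d ∈ p.support, ∀ e ∈ d.support, e.1 ∈ R ∧ e.2 ∈ R) :
    aeval (fun e : Fin (2 * n) × Fin (2 * n) =>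
        if e.1 ∈ R ∧ e.2 ∈ R then (1 : MvPolynomial (Fin (2 * n) × Fin (2 * n)) ℝ≥0) else X e) p
      = C (∑ d ∈ p.support, coeff d p) :=
  aeval_eq_C_sum_coeff _ fun d hd e he => if_pos (hint d hd e he)

/-- Over `ℝ≥0` the sum of the coefficients of a nonzero polynomial is nonzero. [folklore] -/
theorem sum_coeff_ne_zero {σ : Type*} {p : MvPolynomial σ ℝ≥0} (hp : p ≠ 0) :
    ∑ d ∈ p.support, coeff d p ≠ 0 := by
  obtain ⟨d, hd⟩ := support_nonempty.2 hp
  intro h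
  have := (sum_eq_zero_iff.1 h) d hd
  exact (mem_support_iff.1 hd) this

/-- **Killing an internal cofactor.**  If `p ≠ 0` is internal on `R`, then
`L₊((Σ_{M ∈ 𝓕_R} x^M) · η) ≤ L₊(NN_n · p)` with `η = Σ coeff p ≠ 0`, provided `𝓕_R ≠ ∅`:
take the top `w_R`-component (free, multiplicative, `= (Σ_{𝓕_R} x^M) · p`) and substitute `1` for
the `R × R` variables (free). [folklore] -/
theorem complexity_family_mul_C_le {n : ℕ} (R : Finset (Fin (2 * n)))
    (hne : ((nestFreeMatchings (2 * n)).filter fun M => ∀ r ∈ R, M r ∉ R).Nonempty)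
    {p : MvPolynomial (Fin (2 * n) × Fin (2 * n)) ℝ≥0}
    (hint : ∀ d ∈ p.support, ∀ e ∈ d.support, e.1 ∈ R ∧ e.2 ∈ R) :
    complexity ((∑ M ∈ (nestFreeMatchings (2 * n)).filter (fun M => ∀ r ∈ R, M r ∉ R),
        arcMonomial ℝ≥0 M) * C (∑ d ∈ p.support, coeff d p))
      ≤ complexity (nestFreeMatchingPoly n ℝ≥0 * p) := by
  classical
  set W : Fin (2 * n) × Fin (2 * n) → ℕ := fun e => if e.1 ∈ R ∧ e.2 ∈ R then 0 else 1 with hW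
  set φ : Fin (2 * n) × Fin (2 * n) → MvPolynomial (Fin (2 * n) × Fin (2 * n)) ℝ≥0 := fun e =>
    if e.1 ∈ R ∧ e.2 ∈ R then (1 : MvPolynomial (Fin (2 * n) × Fin (2 * n)) ℝ≥0) else X e with hφ
  have htop : topComponent W (nestFreeMatchingPoly n ℝ≥0 * p)
      = (∑ M ∈ (nestFreeMatchings (2 * n)).filter (fun M => ∀ r ∈ R, M r ∉ R), arcMonomial ℝ≥0 M) * p := by
    rw [topComponent_mul, topComponent_rrWeight_nestFreeMatchingPoly R hne,
      topComponent_rrWeight_eq_self_of_internal R hint]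
  have haeval : aeval φ (topComponent W (nestFreeMatchingPoly n ℝ≥0 * p))
      = (∑ M ∈ (nestFreeMatchings (2 * n)).filter (fun M => ∀ r ∈ R, M r ∉ R), arcMonomial ℝ≥0 M)
        * C (∑ d ∈ p.support, coeff d p) := by
    rw [htop, map_mul, aeval_rrOne_family, aeval_rrOne_internal R hint]
  have hfree : ∀ e, complexity (φ e) = 0 := by
    intro e
    by_cases he : e.1 ∈ R ∧ e.2 ∈ R
    · simp only [hφ, if_pos he]; rw [← C_1]; exact complexity_C_holds _
    · simp only [hφ, if_neg he]; exact complexity_X_holds _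
  rw [← haeval]
  exact (complexity_aeval_le_of_free φ hfree _).trans (complexity_topComponent_le W _)

/-! ### The union bound for an arbitrary family of perfect matchings -/

/-- **Union bound for a family.**  Let `𝓕` be a family of perfect matchings of `[2n]`, `n ≥ 3`,
`g ∈ ℝ≥0[x]` with support exactly the arc sets of `𝓕`, and `μ ≥ 0` a weighting of `𝓕` of total
mass `1`.  Then some balanced `S ⊆ [2n]` (`2n < 3|S| ≤ 4n`) is respected by the members of `𝓕`
with mass at least `1 / (4 · L₊(g) · (n+1)²)`: the homogeneous structure theorem, balanced products
live on one vertex split (`exists_balanced_vertex_split_of_support_subset`), heaviest class.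
[folklore] -/
theorem exists_balanced_split_of_complexity_family {n : ℕ} (hn : 3 ≤ n)
    {𝓕 : Finset (Fin (2 * n) → Fin (2 * n))} (h𝓕 : 𝓕 ⊆ perfectMatchings (2 * n))
    {g : MvPolynomial (Fin (2 * n) × Fin (2 * n)) ℝ≥0} (hg : g.support = 𝓕.image arcExponent)
    (μ : (Fin (2 * n) → Fin (2 * n)) → ℝ≥0) (hμ : ∑ M ∈ 𝓕, μ M = 1) :
    ∃ S : Finset (Fin (2 * n)), 2 * n < 3 * S.card ∧ 3 * S.card ≤ 4 * n ∧
      (1 : ℝ≥0) ≤ (4 * complexity g * (n + 1) ^ 2 : ℕ) *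
        ∑ M ∈ 𝓕.filter (fun M => ∀ i, i ∈ S ↔ M i ∈ S), μ M := by
  classical
  set s := complexity g with hs
  -- `g` is homogeneous of degree `n`
  have hhom : g.IsHomogeneous n := by
    intro d hd
    have hd' : d ∈ g.support := mem_support_iff.2 hd
    rw [hg, mem_image] at hd'
    obtain ⟨M, hM, rfl⟩ := hd'
    have h1 := arcMonomial_isHomogeneous (k := ℝ≥0) M
    rw [card_openers (h𝓕 hM), arcMonomial_eq_monomial] at h1
    have := h1 (d := arcExponent M) (by rw [coeff_monomial, if_pos rfl]; exact one_ne_zero)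
    exact this
  obtain ⟨L, hLlen, hLsum, hL⟩ := exists_homogeneous_balanced_decomposition_of_complexity_le
    (le_refl s) hhom hn
  have hsuppF : (∑ M ∈ 𝓕, arcMonomial ℝ≥0 M).support = 𝓕.image arcExponent :=
    support_sum_arcMonomial h𝓕
  -- the splits attached to the terms
  have hsplit : ∀ t ∈ L, ∃ S : Finset (Fin (2 * n)), 2 * n < 3 * S.card ∧ 3 * S.card ≤ 4 * n ∧
      ∀ x ∈ (t.2.1 * t.2.2).support, ∃ M ∈ 𝓕, arcExponent M = x ∧ ∀ i, i ∈ S ↔ M i ∈ S := by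
    intro t ht
    obtain ⟨hhom', h1, h2, hne, hle⟩ := hL t ht
    have hsub : (t.2.1 * t.2.2).support ⊆ (∑ M ∈ 𝓕, arcMonomial ℝ≥0 M).support := by
      intro x hx
      rw [hsuppF, ← hg, mem_support_iff]
      have := hle x
      intro h0
      rw [h0] at this
      exact (mem_support_iff.1 hx) (le_antisymm this zero_le)
    obtain ⟨S, hScard, hS⟩ := exists_balanced_vertex_split_of_support_subset h𝓕 hhom' hne hsub
    exact ⟨S, by omega, by omega, hS⟩
  choose! Sp hSp using hsplit
  -- every member of `𝓕` lies in the class of some term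
  have hcover : ∀ M ∈ 𝓕, ∃ t ∈ L, ∀ i, i ∈ Sp t ↔ M i ∈ Sp t := by
    intro M hM
    have hx : arcExponent M ∈ g.support := by
      rw [hg, mem_image]; exact ⟨M, hM, rfl⟩
    have hx' : ∃ t ∈ L, arcExponent M ∈ (t.2.1 * t.2.2).support := by
      by_contra hcon
      push Not at hcon
      rw [mem_support_iff, ← hLsum] at hx
      apply hx
      rw [← coeffAddMonoidHom_apply, map_list_sum]
      apply List.sum_eq_zero
      intro c hc
      rw [List.map_map, List.mem_map] at hc
      obtain ⟨t, ht, rfl⟩ := hc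
      simpa [coeffAddMonoidHom_apply, notMem_support_iff] using hcon t ht
    obtain ⟨t, ht, hxt⟩ := hx'
    obtain ⟨M', hM', hM'x, hresp⟩ := (hSp t ht).2.2 _ hxt
    have hMM' : M' = M := arcExponent_injOn (h𝓕 hM') (h𝓕 hM) hM'x
    subst hMM'
    exact ⟨t, ht, hresp⟩
  -- the union bound
  set T := L.toFinset with hT
  set mass : (ℕ × MvPolynomial (Fin (2 * n) × Fin (2 * n)) ℝ≥0 ×
      MvPolynomial (Fin (2 * n) × Fin (2 * n)) ℝ≥0) → ℝ≥0 := fun t =>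
    ∑ M ∈ 𝓕.filter (fun M => ∀ i, i ∈ Sp t ↔ M i ∈ Sp t), μ M with hmass
  have hbound : (1 : ℝ≥0) ≤ ∑ t ∈ T, mass t := by
    rw [← hμ]
    have hrw : ∀ t ∈ T, mass t = ∑ M ∈ 𝓕, if (∀ i, i ∈ Sp t ↔ M i ∈ Sp t) then μ M else 0 := by
      intro t _
      simp only [hmass]
      rw [sum_filter]
    rw [sum_congr rfl hrw, sum_comm]
    refine sum_le_sum fun M hM => ?_
    obtain ⟨t, ht, hresp⟩ := hcover M hM
    have ht' : t ∈ T := by rw [hT, List.mem_toFinset]; exact ht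
    refine le_trans ?_ (single_le_sum (f := fun t => if (∀ i, i ∈ Sp t ↔ M i ∈ Sp t)
      then μ M else 0) (fun _ _ => zero_le) ht')
    simp only [if_pos hresp, le_refl]
  have hTne : T.Nonempty := by
    rw [nonempty_iff_ne_empty]
    rintro hTe
    rw [hTe, sum_empty] at hbound
    exact absurd hbound (by simp)
  obtain ⟨t₀, ht₀, hmax⟩ := exists_max_image T mass hTne
  have ht₀L : t₀ ∈ L := by rw [hT, List.mem_toFinset] at ht₀; exact ht₀
  refine ⟨Sp t₀, (hSp t₀ ht₀L).1, (hSp t₀ ht₀L).2.1, ?_⟩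
  calc (1 : ℝ≥0) ≤ ∑ t ∈ T, mass t := hbound
    _ ≤ ∑ _t ∈ T, mass t₀ := sum_le_sum hmax
    _ = (T.card : ℝ≥0) * mass t₀ := by rw [sum_const, nsmul_eq_mul]
    _ ≤ ((4 * s * (n + 1) ^ 2 : ℕ) : ℝ≥0) * mass t₀ := by
        gcongr
        exact_mod_cast (List.toFinset_card_le (l := L)).trans hLlen

/-! ### S2b from spread measures on `𝓕_R` -/

/-- **Stub S2b `stub_denseInternalHard` from spread measures on the sub-family `𝓕_R`.**  Suppose
that for some `a`, for every `c` and all large `n`, for every `R ⊆ [2n]` with `a·|R| ≤ 2n` whose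
complement has no run of length `2((log₂ n + c)^c + log₂ n + 1)^6 + 12`, there is a probability
weighting `μ` of `𝓕_R = {M nest-free perfect matching : ∀ r ∈ R, M r ∉ R}` under which every balanced
split `S` (`2n < 3|S| ≤ 4n`) satisfies `4 · 2^((log₂ n + c)^c) · (n+1)² · μ{M ∈ 𝓕_R : M respects S} < 1`.
Then S2b holds verbatim: internal cofactors `p ≠ 0` on such `R` (with `a · deg p ≤ n`) have
`2^((log₂ n + c)^c) < L₊(NN_n · p)`.  Proof: `complexity_family_mul_C_le` and the union bound
`exists_balanced_split_of_complexity_family`. [folklore] -/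
theorem denseInternalHard_of_familySpread
    (H : ∃ a : ℕ, ∀ c : ℕ, ∃ n₀ : ℕ, ∀ n ≥ n₀, ∀ R : Finset (Fin (2 * n)), a * R.card ≤ 2 * n →
      (¬ ∃ s : ℕ, s + (2 * ((Nat.log 2 n + c) ^ c + Nat.log 2 n + 1) ^ 6 + 12) ≤ 2 * n ∧
        ∀ j : Fin (2 * n), s ≤ j.val →
          j.val < s + (2 * ((Nat.log 2 n + c) ^ c + Nat.log 2 n + 1) ^ 6 + 12) → j ∉ R) →
      ∃ μ : (Fin (2 * n) → Fin (2 * n)) → ℝ≥0,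
        (∑ M ∈ (nestFreeMatchings (2 * n)).filter (fun M => ∀ r ∈ R, M r ∉ R), μ M = 1) ∧
        ∀ S : Finset (Fin (2 * n)), 2 * n < 3 * S.card → 3 * S.card ≤ 4 * n →
          ((4 * 2 ^ ((Nat.log 2 n + c) ^ c) * (n + 1) ^ 2 : ℕ) : ℝ≥0) *
            (∑ M ∈ ((nestFreeMatchings (2 * n)).filter (fun M => ∀ r ∈ R, M r ∉ R)).filter
              (fun M => ∀ i, i ∈ S ↔ M i ∈ S), μ M) < 1) :
    ∃ a : ℕ, ∀ c : ℕ, ∃ n₀ : ℕ, ∀ n ≥ n₀, ∀ R : Finset (Fin (2 * n)), a * R.card ≤ 2 * n →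
      (¬ ∃ s : ℕ, s + (2 * ((Nat.log 2 n + c) ^ c + Nat.log 2 n + 1) ^ 6 + 12) ≤ 2 * n ∧
        ∀ j : Fin (2 * n), s ≤ j.val →
          j.val < s + (2 * ((Nat.log 2 n + c) ^ c + Nat.log 2 n + 1) ^ 6 + 12) → j ∉ R) →
      ∀ p : MvPolynomial (Fin (2 * n) × Fin (2 * n)) ℝ≥0, p ≠ 0 → a * p.totalDegree ≤ n →
        (∀ d ∈ p.support, ∀ e ∈ d.support, e.1 ∈ R ∧ e.2 ∈ R) →
          2 ^ ((Nat.log 2 n + c) ^ c) < complexity (nestFreeMatchingPoly n ℝ≥0 * p) := by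
  classical
  obtain ⟨a, ha⟩ := H
  refine ⟨a, fun c => ?_⟩
  obtain ⟨n₀, hn₀⟩ := ha c
  refine ⟨max n₀ 3, fun n hn R hRa hrun p hp _ hint => ?_⟩
  have hn3 : 3 ≤ n := le_of_max_le_right hn
  obtain ⟨μ, hμ1, hμS⟩ := hn₀ n (le_of_max_le_left hn) R hRa hrun
  set 𝓕 := (nestFreeMatchings (2 * n)).filter (fun M => ∀ r ∈ R, M r ∉ R) with h𝓕def
  have h𝓕 : 𝓕 ⊆ perfectMatchings (2 * n) :=
    (filter_subset _ _).trans nestFreeMatchings_subset_perfectMatchings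
  have hne : 𝓕.Nonempty := by
    rw [nonempty_iff_ne_empty]
    intro h
    rw [h, sum_empty] at hμ1
    exact zero_ne_one hμ1
  set η : ℝ≥0 := ∑ d ∈ p.support, coeff d p with hη
  have hη0 : η ≠ 0 := sum_coeff_ne_zero hp
  set g := (∑ M ∈ 𝓕, arcMonomial ℝ≥0 M) * C η with hgdef
  have hgsupp : g.support = 𝓕.image arcExponent := by
    rw [hgdef, support_mul_C_of_ne_zero _ hη0, support_sum_arcMonomial h𝓕]
  have hgc : complexity g ≤ complexity (nestFreeMatchingPoly n ℝ≥0 * p) :=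
    complexity_family_mul_C_le R hne hint
  obtain ⟨S, hS1, hS2, hbig⟩ := exists_balanced_split_of_complexity_family hn3 h𝓕 hgsupp μ hμ1
  have hlt := hμS S hS1 hS2
  by_contra hcon
  push Not at hcon
  have hmono : ((4 * complexity g * (n + 1) ^ 2 : ℕ) : ℝ≥0) ≤
      ((4 * 2 ^ ((Nat.log 2 n + c) ^ c) * (n + 1) ^ 2 : ℕ) : ℝ≥0) := by
    exact_mod_cast Nat.mul_le_mul_right _ (Nat.mul_le_mul_left _ (hgc.trans hcon))
  exact absurd (lt_of_le_of_lt (hbig.trans (mul_le_mul_of_nonneg_right hmono zero_le)) hlt)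
    (lt_irrefl _)

end Summit.ValiantsHypothesis.ValiantsHypothesis.Theorems.FifoMatching.NNLinearDegreeCofactorHard

end
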